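import Summits.QuantumFields.YangMills.Theorems.BalabanUVNodesN16Thm4TorusOfHP2PerUniform

/-!
# Route «BalabanUVNodes», crux K3⁸ `SpineGivenEndpointR13SepCoPHV` (stmt-QuantumFields-27366), node N16 = NE3 — NODE N05's ∀-P («Σ») OBJECT ⟹ NODE N16's CHAIN-ENTRY
# HYPOTHESIS (T4ᵀ_print)_β WITH ONE `(c₁′, B, B_h)` FOR ALL DEPTHS: the conclusion shape of dag-n05-d's
# `…N05SubBP2DK2PerKappaThm4Prop3BodiesUniformPOfBindersLettersPerDoorL.exists_thm4Body_prop3Body_uniformP_of_bindersLettersPer_doorL` (p681888) at the period family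
# `Pf ν := Nper·Lᵛ`, `ν : {k ∕∕ 1 ≤ k}`, displayed as ONE hypothesis, ⟹ `∃ B B_h c₁′, ∀ k ≥ 1, Thm4TorusAt θ.L k (Nper·Lᵏ) (Lᵏ)⁻¹ c₁′ (unitaryUnits θ.𝔸) (Reg k) (Restr129 …) Concl_entry(B, B_h; β)`

Cell `pub-ymgap`, seat `pub-ymgap-dag-n16-e` (R134 (a), strategy s2; HUMAN RULING D-0062; chair R424 venue), generation 23.  `--kind proof --supports stmt-QuantumFields-27366 --as helper`
(count-neutral; proves NO registered stub).  `bears_on: R4∕N16 · edge N05 → N16`.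

WHY (the N05-record-currency seam's last N16-side piece before the top knit).  dag-n05-d g22 closed (g6) N05-side (p681888, I.44317): for ANY family of periods `Pf : ι → ℕ`, under
node N06's per-period binders and [4]'s periodic letters, ONE `(inp, B₀β, B₈, c₄, c₃)` with Theorem 4's body at threshold `c₄` (radius constant `5·D·L·B₈`) and Proposition 3's body at
threshold `c₃` on the periodic δ₂-model at EVERY member of EVERY period's κ-cut.  At `ι := {k ∕∕ 1 ≤ k}`, `Pf ν := Nper·Lᵛ` that is this seat's `hSig` (p682027
`…HP2PerUniform`) with `B₁′ := 5·D·L·B₈ ≥ 5·D·L·inp.B₀`; `exists_window_thm4TorusAt_entry_forall_depth_of_uniform_bodies` then gives ONE window letter `c₁′` and node N16's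
chain-entry `Thm4TorusAt` at every depth, and `16·B·c₁′ ≤ 1` (n16-c's `n16_of_leaf` letter) falls out of the window at `α₀ = α₁ = c₁′∕2`.  The hypothesis `hN05` IS p681888's
conclusion text at that family with its three pin equations dropped (N16 does not read them); a consumer holding node N06's binders discharges it by `exact ⟨_, _, _, _, _, (p681888 …).…⟩`.

WHAT THIS FILE PROVES (kernel; one theorem, 0 `def`, 0 `sorry`): ★★★ `exists_thm4TorusAt_entry_forall_depth_of_n05UniformP`.

HONEST FRAMING.  Bookkeeping BY NAME; no estimate; `hN05` (node N05's Σ-object) is a HYPOTHESIS here — node N05's theorem p681888 inhabits it GIVEN node N06's per-period binders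
and [4]'s periodic letters at every `Nper·Lᵏ` with k-uniform outer constants (displayed THERE; N06 content, not discharged); nothing of Bałaban asserted; no stub of K3⁸ closed or claimed;
N16 ∕ N05 ∕ N06 NOT discharged; counts UNMOVED (typed 28∕28 · discharged 5∕27 · A 5∕28).  One finite four-torus at fixed `ε` — NOT ℝ⁴, NOT infinite volume, NOT OS, NOT a mass gap;
the YM mass gap (Clay) is NOT proved by any of this.
References: [Balaban1985RegularSpaces] T. Bałaban, CMP **99** (1985) 75–102, Thm 4 p. 88 («There exists a constant c₁»), Prop. 3 p. 87, (1.36)–(1.39) pp. 82–83, p. 77.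
-/

set_option autoImplicit false

open scoped BigOperators
open NormedSpace

namespace Summit.QuantumFields.YangMills.BalabanUVNodes.N16.Thm4TorusEntryOfN05UniformP

open Literature.MathematicalPhysics.QuantumFieldTheory.Balaban1983to89
open B7Prop1Explicit B7Prop2Explicit
open B7Eq78Linearization (conjR)
open B7Eq92Concrete (mgauge)
open B8Ineq132 (covDerivFwd)
open B8Eq184Proof (cfgExp)
open B8Eq119TwistedAxial (Restr129)
open B8Eq138LandauZd (IsLandau138 covLap)
open B8Thm4TorusAt (torusLam Thm4TorusAt)
open B8LeafModelZdHP2Per (zdGF3HP₂Per)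
open Node00 (Stage3Params IdxB8SubDPerκ)
open Thm4TorusOfHP2PerUniform (exists_window_thm4TorusAt_entry_forall_depth_of_uniform_bodies)

noncomputable section

/-- **★★★ NODE N05's Σ-OBJECT ⟹ NODE N16's CHAIN-ENTRY HYPOTHESIS, ONE `(c₁′, B, B_h)` FOR ALL DEPTHS.**  Stage-3 parameters `θ` (`θ.D ≥ 2`), torus count `Nper ≥ 1`, pins
`(Mκ, Rκ)`, Hölder pair `(β, len)` with `0 ≤ β`, `len ≥ 1` on its support, `len (e μ) = 1`; `hN05` = the conclusion of node N05's `exists_thm4Body_prop3Body_uniformP_of_bindersLettersPer_doorL`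
at the period family `ν ↦ Nper·θ.L^ν` (`ν : {k ∕∕ 1 ≤ k}`), pin equations dropped.  THEN `∃ B B_h c₁′` with `0 < c₁′`, `16·B·c₁′ ≤ 1` and, for EVERY `k ≥ 1` and every `Reg`,
`Thm4TorusAt θ.L k (Nper·Lᵏ) (Lᵏ)⁻¹ c₁′ (unitaryUnits θ.𝔸) (Reg k) (Restr129 θ.L k (torusLam k)) Concl_entry(B, B_h; β)` in the letters of
`…N16HolderOfThm4Output.n16_holder_of_thm4TorusAt_print` (`B = 5DL·inp.B₀`, `B_h = 5DL·B₀β`; `conjR` = `Ad` on matrices, `rfl`).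
[cite: Balaban1985RegularSpaces, Thm 4 p.88 («There exists a constant c₁»), Prop. 3 p.87, (1.36)–(1.39) pp.82–83, p.77 («we admit the case where some domains Ω_j are equal to T_η»)] -/
theorem exists_thm4TorusAt_entry_forall_depth_of_n05UniformP {θ : Stage3Params} (hD : 2 ≤ θ.D) {Nper : ℕ} (hN : 1 ≤ Nper) (Mκ Rκ : ℕ)
    {β : ℝ} (hβ : 0 ≤ β) {len : Site θ.D → ℝ} (hlen : ∀ v : Site θ.D, 0 < len v → 1 ≤ len v) (hlen1 : ∀ μ : Fin θ.D, len (e μ) = 1)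
    (hN05 : ∃ (inp : B8.B9Inputs) (B₀β B₈ c₄ c₃ : ℝ), inp.B₀ ≤ B₈ ∧ 0 < c₄ ∧ 0 < c₃ ∧
      ∀ (ν : {k : ℕ // 1 ≤ k}) (a : IdxB8SubDPerκ θ (Nper * θ.L ^ ν.1) Mκ Rκ),
        B8.Thm4Body c₄ (5 * (θ.D : ℝ) * θ.L * B₈) (fun _ : Unit => (zdGF3HP₂Per θ.𝔸 θ.L β len a.toZdIdx (Nper * θ.L ^ ν.1)).toGFData) ∧
        B8.Prop3Body c₃ θ.D (θ.L : ℝ) (2097152 * ((θ.D : ℝ) + 1) ^ 2 * (θ.L : ℝ) ^ 2) inp B₀β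
          (fun _ : Unit => (zdGF3HP₂Per θ.𝔸 θ.L β len a.toZdIdx (Nper * θ.L ^ ν.1)).toGFData2))
    (Reg : ℕ → (Site θ.D → Fin θ.D → θ.𝔸ˣ) → Prop) :
    ∃ B Bh c₁' : ℝ, 0 < c₁' ∧ 16 * (B * c₁') ≤ 1 ∧
      ∀ k, 1 ≤ k → Thm4TorusAt θ.L k (((Nper * θ.L ^ k : ℕ) : ℤ)) (((θ.L : ℝ) ^ k)⁻¹) c₁' (unitaryUnits θ.𝔸) (Reg k) (Restr129 θ.L k (torusLam k))
        (fun (α₀ α₁ : ℝ) (U₀ U' : Site θ.D → Fin θ.D → θ.𝔸ˣ) (u : Site θ.D → θ.𝔸ˣ) =>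
          ∃ A : Site θ.D → Fin θ.D → θ.𝔸,
            (∀ x μ, IsSelfAdjoint (A x μ)) ∧ (∀ (x : Site θ.D) (κ μ : Fin θ.D), A (x + (((Nper * θ.L ^ k : ℕ) : ℤ)) • e κ) μ = A x μ) ∧
            mgauge U₀ u (cfgExp (((θ.L : ℝ) ^ k)⁻¹) A) = U' ∧
            (∀ x μ, ‖A x μ‖ ≤ B * (α₀ + α₁)) ∧
            (∀ (μ : Fin θ.D) (x : Site θ.D) (κ : Fin θ.D), ‖covDerivFwd (((θ.L : ℝ) ^ k)⁻¹) U₀ μ (fun z => A z κ) x‖ ≤ B * (α₀ + α₁)) ∧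
            IsLandau138 θ.L k (((θ.L : ℝ) ^ k)⁻¹) Set.univ (torusLam k) U₀ A ∧
            (∀ (μ : Fin θ.D) (y : Site θ.D) (κ : Fin θ.D),
              ‖conjR (U₀ y μ) (covDerivFwd (((θ.L : ℝ) ^ k)⁻¹) U₀ μ (fun z => A z κ) (y + e μ)) - covDerivFwd (((θ.L : ℝ) ^ k)⁻¹) U₀ μ (fun z => A z κ) y‖
                ≤ Bh * (α₀ + α₁) * (((θ.L : ℝ)⁻¹) ^ k) ^ β) ∧
            (∀ (x : Site θ.D) (κ : Fin θ.D), ‖covLap (((θ.L : ℝ) ^ k)⁻¹) U₀ (fun z => A z κ) x‖ ≤ B * (α₀ + α₁))) := by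
  obtain ⟨inp, B₀β, B₈, c₄, c₃, hB08, hc₄, hc₃, H⟩ := hN05
  have h5 : 0 < 5 * (θ.D : ℝ) * θ.L := by
    have hD0 : (0 : ℝ) < θ.D := by exact_mod_cast lt_of_lt_of_le (by norm_num) hD
    have hL0 : (0 : ℝ) < θ.L := by exact_mod_cast lt_of_lt_of_le (by norm_num) θ.two_le_L
    positivity
  have hB₈ : 0 < B₈ := lt_of_lt_of_le inp.B₀_pos hB08
  have hB₁' : 0 < 5 * (θ.D : ℝ) * θ.L * B₈ := mul_pos h5 hB₈
  have hBB : 5 * (θ.D : ℝ) * θ.L * inp.B₀ ≤ 5 * (θ.D : ℝ) * θ.L * B₈ := mul_le_mul_of_nonneg_left hB08 h5.le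
  obtain ⟨c₁', hc₁', hwin, hT⟩ := exists_window_thm4TorusAt_entry_forall_depth_of_uniform_bodies hD hN Mκ Rκ hβ hlen hlen1 hc₄ hc₃ hB₁' hBB
    (fun k hk a => H ⟨k, hk⟩ a) Reg
  refine ⟨5 * (θ.D : ℝ) * θ.L * inp.B₀, 5 * (θ.D : ℝ) * θ.L * B₀β, c₁', hc₁', ?_, hT⟩
  -- `16·B·c₁′ ≤ 1` from the window at `α₀ = α₁ = c₁′/2` and `B ≤ B₁′`
  have hh : 0 < c₁' / 2 := by linarith
  obtain ⟨-, -, -, h16, -⟩ := hwin (c₁' / 2) (c₁' / 2) hh hh (by linarith)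
  have hs : c₁' / 2 + c₁' / 2 = c₁' := by ring
  rw [hs] at h16
  have hB0 : 0 ≤ 5 * (θ.D : ℝ) * θ.L * inp.B₀ := by have := inp.B₀_pos.le; positivity
  nlinarith [mul_le_mul_of_nonneg_right hBB hc₁'.le]

end

end Summit.QuantumFields.YangMills.BalabanUVNodes.N16.Thm4TorusEntryOfN05UniformP
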